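import Literature.Topology.FourManifolds.SliceRibbon
import Literature.Topology.FourManifolds.NormalFrameTransport
import Literature.Analysis.Calculus.Sard
import Mathlib.Analysis.Calculus.BumpFunction.InnerProduct
import Mathlib.Analysis.Calculus.FDeriv.CompCLM
import HarnessLib

/-!
# Slice discs whose radius function is Morse

Topic `Literature/Topology/FourManifolds`; a brick towards the Morse-theoretic normal forms of
slice discs (`Knot.IsRibbonDisc` of `SliceRibbon.lean` is `IsSliceDisc ∧ (ρ Morse on the open
disc) ∧ (no interior local maxima)`). Everything in this file is **proved**; there are no named
facts, no new definitions, no `sorry`.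

* `Literature.Topology.FourManifolds.Knot.IsSliceDisc.exists_isSliceDisc_radialMorse` (**main
  theorem**): every smooth slice disc `f` of a knot `K` (`Knot.IsSliceDisc K f`) can be replaced
  by a slice disc `g` **of the same knot** whose squared radius function `ρ_g = ‖g‖²` is Morse on
  the open unit disc: at every interior critical point `x` of `ρ_g` the Hessian
  `iteratedFDeriv ℝ 2 ρ_g x` is nondegenerate — literally the Morse clause of `Knot.IsRibbonDisc`.

## Proof

The classical input is Milnor, *Morse theory* (1963), §6, Thm. 6.6: *for almost all `p ∈ ℝⁿ`
the distance-squared function `L_p = ‖· - p‖²` on an immersed submanifold `M ⊂ ℝⁿ` has no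
degenerate critical points* (the degenerate centres are the focal points of `M`, the critical
values of the endpoint map of the normal bundle, a null set by Sard's theorem (Sard 1942;
Guillemin–Pollack, Ch. 1 §7)). We prove it here for an immersed `2`-disc in `ℝ⁴` and combine it
with a perturbation of the slice disc supported away from the boundary sphere.

1. **Calculus** (`fderiv_norm_add_sq_apply`, `iteratedFDeriv_two_norm_add_sq`,
   `inner_fderiv_normal_add_inner_iteratedFDeriv`): `D(‖f + a‖²)(x) w = 2⟪f x + a, Df w⟫`,
   `D²(‖f + a‖²)(x)(v, w) = 2(⟪Df v, Df w⟫ + ⟪f x + a, D²f(v, w)⟫)`, and the Weingarten identity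
   `⟪Dν v, Df w⟫ = -⟪ν, D²f(v, w)⟫` for a normal field `ν`.
2. **Linear algebra** (`exists_eq_smul_add_smul_of_inner_eq_zero`,
   `exists_ne_zero_endpointDeriv_eq_zero`): for a normal frame `n₀, n₁` of the immersion
   (the tree's `exists_normalFrame`, `NormalFrameTransport.lean`) the normal space is
   `span {n₀, n₁}`; if `x` is a degenerate critical point of `‖f + a‖²` then `a = E(x, c)` for the
   **endpoint map** `E(x, c) = c₀ n₀(x) + c₁ n₁(x) - f x : ℝ² × ℝ² → ℝ⁴` and `DE(x, c)` has a
   nonzero kernel vector (Milnor's focal point computation).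
3. **Sard** (`volume_setOf_degenerate_norm_add_sq_eq_zero`): hence the set of `a ∈ ℝ⁴` for which
   `‖f + a‖²` has a degenerate critical point on the closed unit disc lies in the set of critical
   values of the equidimensional `C^∞` map `E`, which is Lebesgue-null by Mathlib's
   fixed-dimension Sard lemma `MeasureTheory.addHaar_image_eq_zero_of_det_fderivWithin_eq_zero`
   (transported through a linear identification `ℝ² × ℝ² ≃ ℝ⁴`).
4. **Perturbation** (`exists_collar_fderiv_norm_sq_pos`, `eventually_forall_fderiv_norm_sq_pos`,
   `Knot.IsSliceDisc.add_bump_smul`): by neatness `ρ_f` has positive radial derivative on a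
   collar `1 - η ≤ ‖x‖ ≤ 1`, and the inner disc `‖x‖ ≤ 1 - η` is mapped into a ball `‖z‖ ≤ M < 1`.
   With a bump function `φ` on `ℝ⁴` equal to `1` on `‖z‖ ≤ r₁` and to `0` on `‖z‖ ≥ r₂`
   (`M < r₁ < r₂ < 1`, Mathlib's `ContDiffBump`), put `g = f + (φ ∘ f) • a`, the image of `f`
   under the translation-like diffeomorphism `z ↦ z + φ(z) a` of `ℝ⁴` (identity near `𝕊³`,
   preserving the open unit ball for `a` small). For all small `a`: `g` is a slice disc of `K`;
   `ρ_g` has no critical points on the collar (compactness, joint continuity of the derivative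
   in `(a, x)`); and `ρ_g = ‖f + a‖²` near each point of the inner disc. The admissible `a` form a
   neighbourhood of `0`, of positive measure, so one of them avoids the null set of Step 3.

## References

* J. Milnor, *Morse theory*, Ann. of Math. Studies 51 (1963), §6 (focal points, the endpoint
  map), Thm. 6.6. [MilnorMorseTheory1963]
* A. Sard, *The measure of the critical values of differentiable maps*, Bull. Amer. Math. Soc.
  48 (1942), 883–890. [Sard1942]
* V. Guillemin, A. Pollack, *Differential topology* (1974), Ch. 1 §7 (Sard's theorem and Morse
  functions: "almost every height/distance function is Morse"). [GuilleminPollack1974]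
* R. Gompf, A. Stipsicz, *4-manifolds and Kirby calculus* (1999), §6.2 (ribbon discs and the
  radius function on slice discs).

## Design notes

* No new definitions: the perturbation `f + (φ ∘ f) • a`, the endpoint map and its differential
  are written out inside the statements and proofs; the normal frame comes from
  `exists_normalFrame` (a *global* frame on the disc, so a single Sard application suffices).
* The measure is Mathlib's `volume` on `EuclideanSpace ℝ (Fin 4)` (an additive Haar measure);
  the non-Morse translations are only shown to lie in a null set (no measurability is claimed).
* Not here: removing the interior local maxima (the remaining clause of `Knot.IsRibbonDisc`, which
  is the slice–ribbon problem), and the analogous statement for concordances.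
-/

open scoped Manifold ContDiff Topology RealInnerProductSpace NNReal
open Function Set Metric MeasureTheory Filter

noncomputable section

namespace Literature.Topology.FourManifolds

/-! ### Calculus of the translated radius-squared function `y ↦ ‖f y + a‖ ^ 2` -/

section Calculus

variable {E F : Type*} [NormedAddCommGroup E] [NormedSpace ℝ E]
  [NormedAddCommGroup F] [InnerProductSpace ℝ F]

/-- The differential of `y ↦ ‖f y + a‖ ^ 2` is `w ↦ 2 ⟪f x + a, Df(x) w⟫`. [folklore] -/
theorem fderiv_norm_add_sq_apply {f : E → F} {x : E} (hf : DifferentiableAt ℝ f x) (a : F) (w : E) :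
    fderiv ℝ (fun y ↦ ‖f y + a‖ ^ 2) x w = 2 * ⟪f x + a, fderiv ℝ f x w⟫ := by
  have h : HasFDerivAt (fun y ↦ ‖f y + a‖ ^ 2)
      (2 • (innerSL ℝ (f x + a)).comp (fderiv ℝ f x)) x :=
    (hf.hasFDerivAt.add_const a).norm_sq
  rw [h.fderiv]
  simp only [smul_apply, ContinuousLinearMap.coe_comp, comp_apply, innerSL_apply_apply,
    nsmul_eq_mul, Nat.cast_ofNat]

/-- The mixed second derivative `v, w ↦ D(y ↦ Df(y) w)(x) v` is the second derivative
`D²f(x)(v, w)`. [folklore] -/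
theorem fderiv_fderiv_apply_eq_iteratedFDeriv_two {f : E → F} (hf : ContDiff ℝ ∞ f) (x v w : E) :
    fderiv ℝ (fun y ↦ fderiv ℝ f y w) x v = iteratedFDeriv ℝ 2 f x ![v, w] := by
  have hc : DifferentiableAt ℝ (fderiv ℝ f) x :=
    (hf.fderiv_right (m := ∞) (by simp)).differentiable (by simp) x
  rw [iteratedFDeriv_two_apply, fderiv_clm_apply hc (differentiableAt_const w)]
  simp

/-- **Hessian of the translated radius-squared function.** For `C^∞` `f` and a constant vector
`a`, `D²(‖f + a‖²)(x)(v, w) = 2 (⟪Df v, Df w⟫ + ⟪f x + a, D²f(x)(v, w)⟫)`. [folklore] -/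
theorem iteratedFDeriv_two_norm_add_sq {f : E → F} (hf : ContDiff ℝ ∞ f) (a : F) (x v w : E) :
    iteratedFDeriv ℝ 2 (fun y ↦ ‖f y + a‖ ^ 2) x ![v, w] =
      2 * (⟪fderiv ℝ f x v, fderiv ℝ f x w⟫ + ⟪f x + a, iteratedFDeriv ℝ 2 f x ![v, w]⟫) := by
  have hfd : Differentiable ℝ f := hf.differentiable (by simp)
  have hh : ContDiff ℝ ∞ (fun y ↦ ‖f y + a‖ ^ 2) := (hf.add contDiff_const).norm_sq ℝ
  rw [← fderiv_fderiv_apply_eq_iteratedFDeriv_two hh,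
    ← fderiv_fderiv_apply_eq_iteratedFDeriv_two hf]
  have h1 : (fun y ↦ fderiv ℝ (fun y ↦ ‖f y + a‖ ^ 2) y w) =
      fun y ↦ 2 * ⟪f y + a, fderiv ℝ f y w⟫ :=
    funext fun y ↦ fderiv_norm_add_sq_apply (hfd y) a w
  have hcf : DifferentiableAt ℝ (fderiv ℝ f) x :=
    (hf.fderiv_right (m := ∞) (by simp)).differentiable (by simp) x
  have hd3 : DifferentiableAt ℝ (fun y ↦ fderiv ℝ f y w) x :=
    hcf.clm_apply (differentiableAt_const w)
  have h2 : HasFDerivAt (fun y ↦ 2 * ⟪f y + a, fderiv ℝ f y w⟫)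
      ((2 : ℝ) • (fderivInnerCLM ℝ (f x + a, fderiv ℝ f x w)).comp
        ((fderiv ℝ f x).prod (fderiv ℝ (fun y ↦ fderiv ℝ f y w) x))) x :=
    (((hfd x).hasFDerivAt.add_const a).inner ℝ hd3.hasFDerivAt).const_mul 2
  rw [h1, h2.fderiv]
  simp only [smul_apply, ContinuousLinearMap.coe_comp, comp_apply,
    ContinuousLinearMap.prod_apply, fderivInnerCLM_apply, smul_eq_mul]
  rw [real_inner_comm (fderiv ℝ f x w)]
  ring

/-- **Weingarten identity.** If `ν` is a normal field along `f` near `x`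
(`⟪ν y, Df(y) w⟫ = 0` for `y` near `x`), then `⟪Dν(x) v, Df(x) w⟫ = -⟪ν x, D²f(x)(v, w)⟫`.
[folklore] -/
theorem inner_fderiv_normal_add_inner_iteratedFDeriv {f ν : E → F} (hf : ContDiff ℝ ∞ f) {x : E}
    (hν : DifferentiableAt ℝ ν x) (h0 : ∀ᶠ y in 𝓝 x, ∀ w, ⟪ν y, fderiv ℝ f y w⟫ = 0) (v w : E) :
    ⟪fderiv ℝ ν x v, fderiv ℝ f x w⟫ + ⟪ν x, iteratedFDeriv ℝ 2 f x ![v, w]⟫ = 0 := by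
  have hcf : DifferentiableAt ℝ (fderiv ℝ f) x :=
    (hf.fderiv_right (m := ∞) (by simp)).differentiable (by simp) x
  have hd3 : DifferentiableAt ℝ (fun y ↦ fderiv ℝ f y w) x :=
    hcf.clm_apply (differentiableAt_const w)
  have h1 : HasFDerivAt (fun y ↦ ⟪ν y, fderiv ℝ f y w⟫)
      ((fderivInnerCLM ℝ (ν x, fderiv ℝ f x w)).comp
        ((fderiv ℝ ν x).prod (fderiv ℝ (fun y ↦ fderiv ℝ f y w) x))) x :=
    hν.hasFDerivAt.inner ℝ hd3.hasFDerivAt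
  have h2 : fderiv ℝ (fun y ↦ ⟪ν y, fderiv ℝ f y w⟫) x = 0 := by
    have hev : (fun y ↦ ⟪ν y, fderiv ℝ f y w⟫) =ᶠ[𝓝 x] fun _ ↦ (0 : ℝ) := by
      filter_upwards [h0] with y hy using hy w
    rw [hev.fderiv_eq]
    simp
  have h3 := congrArg (fun T : E →L[ℝ] ℝ ↦ T v) (h1.fderiv.symm.trans h2)
  simp only [ContinuousLinearMap.coe_comp, comp_apply, ContinuousLinearMap.prod_apply,
    fderivInnerCLM_apply, zero_apply] at h3
  rw [fderiv_fderiv_apply_eq_iteratedFDeriv_two hf] at h3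
  linarith [h3, real_inner_comm (fderiv ℝ ν x v) (fderiv ℝ f x w)]

end Calculus

/-! ### Linear algebra of a transversal pair of normal vectors -/

section LinearAlgebra

/-- **The normal vectors of a normal frame span the normal space.** If `L : ℝ² → ℝ⁴` is
injective and `n₀, n₁` are linearly independent vectors orthogonal to `range L`, then every
vector orthogonal to `range L` is a combination of `n₀, n₁` (the four vectors `L e₀, L e₁, n₀, n₁`
form a basis of `ℝ⁴`). [folklore] -/
theorem exists_eq_smul_add_smul_of_inner_eq_zero {L : EuclideanSpace ℝ (Fin 2) →L[ℝ] EuclideanSpace ℝ (Fin 4)} (hL : Injective L)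
    {n : Fin 2 → EuclideanSpace ℝ (Fin 4)} (hn : ∀ i a, ⟪L a, n i⟫ = 0) (hli : LinearIndependent ℝ n)
    {z : EuclideanSpace ℝ (Fin 4)} (hz : ∀ a, ⟪L a, z⟫ = 0) :
    ∃ c₀ c₁ : ℝ, z = c₀ • n 0 + c₁ • n 1 := by
  -- the four vectors `L e₀, L e₁, n₀, n₁` are linearly independent, hence span `ℝ⁴`
  have hfix : (fun i ↦ normProj L (n i)) = n := funext fun i ↦ (normProj_eq_self_iff hL _).2 (hn i)
  have hli' : LinearIndependent ℝ (fun i ↦ normProj L (n i)) := by rw [hfix]; exact hli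
  have h4 := (transversal_iff_linearIndependent_four n).1
    ((transversal_iff_linearIndependent_normProj hL n).2 hli')
  have hspan := h4.span_eq_top_of_card_eq_finrank' (by simp)
  have hzmem : z ∈ Submodule.span ℝ (Set.range
      ![L (EuclideanSpace.single 0 1), L (EuclideanSpace.single 1 1), n 0, n 1]) := by
    rw [hspan]; exact Submodule.mem_top
  obtain ⟨c, hc⟩ := (Submodule.mem_span_range_iff_exists_fun ℝ).1 hzmem
  rw [Fin.sum_univ_four] at hc
  simp only [Matrix.cons_val_zero, Matrix.cons_val_one, Matrix.cons_val] at hc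
  -- the tangential part `t` of `z` vanishes: it is orthogonal to `z`, to `n₀, n₁`, hence to itself
  set t : EuclideanSpace ℝ (Fin 4) := L (c 0 • EuclideanSpace.single 0 1 + c 1 • EuclideanSpace.single 1 1) with htdef
  have ht : t = c 0 • L (EuclideanSpace.single 0 1) + c 1 • L (EuclideanSpace.single 1 1) := by
    rw [htdef, map_add, map_smul, map_smul]
  have hzt : z = t + (c 2 • n 0 + c 3 • n 1) := by rw [ht, ← hc]; abel
  have htt : ⟪t, t⟫ = 0 := by
    have h1 : ⟪t, z⟫ = 0 := hz _
    rw [hzt, inner_add_right, inner_add_right, real_inner_smul_right, real_inner_smul_right,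
      show ⟪t, n 0⟫ = 0 from hn 0 _, show ⟪t, n 1⟫ = 0 from hn 1 _] at h1
    simpa using h1
  have ht0 : t = 0 := inner_self_eq_zero.1 htt
  exact ⟨c 2, c 3, by rw [hzt, ht0, zero_add]⟩

/-- **Kernel vector of the endpoint-map differential at a degenerate critical point.** The
pointwise linear algebra of Milnor's focal-point computation (*Morse theory* (1963), §6): let
`L = Df(x)` be injective, `ν₀, ν₁` linearly independent normal vectors with "derivatives"
`N₀, N₁` satisfying the Weingarten identity `⟪Nᵢ v, L w⟫ + ⟪νᵢ, B v w⟫ = 0`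
(`B = D²f(x)`), and let `z = c₀ ν₀ + c₁ ν₁` be a normal vector such that the Hessian
`⟪L v, L w⟫ + ⟪z, B v w⟫` of `½‖f + a‖²` (`z = f x + a`) is degenerate. Then the differential
`(v, d) ↦ Σ cᵢ Nᵢ v + Σ dᵢ νᵢ - L v` of the endpoint map `(x, c) ↦ Σ cᵢ νᵢ(x) - f x` has a
nonzero kernel vector. [cite: MilnorMorseTheory1963, §6 (focal points), proof of Thm. 6.6] -/
theorem exists_ne_zero_endpointDeriv_eq_zero {L : EuclideanSpace ℝ (Fin 2) →L[ℝ] EuclideanSpace ℝ (Fin 4)} (hL : Injective L)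
    {ν : Fin 2 → EuclideanSpace ℝ (Fin 4)} (hν : ∀ i a, ⟪L a, ν i⟫ = 0) (hli : LinearIndependent ℝ ν)
    {N : Fin 2 → EuclideanSpace ℝ (Fin 2) →L[ℝ] EuclideanSpace ℝ (Fin 4)} {B : EuclideanSpace ℝ (Fin 2) → EuclideanSpace ℝ (Fin 2) → EuclideanSpace ℝ (Fin 4)}
    (hW : ∀ i v w, ⟪N i v, L w⟫ + ⟪ν i, B v w⟫ = 0) {z : EuclideanSpace ℝ (Fin 4)} {c : EuclideanSpace ℝ (Fin 2)}
    (hz : z = c 0 • ν 0 + c 1 • ν 1)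
    (hdeg : ∃ v, v ≠ 0 ∧ ∀ w, ⟪L v, L w⟫ + ⟪z, B v w⟫ = 0) :
    ∃ p : EuclideanSpace ℝ (Fin 2) × EuclideanSpace ℝ (Fin 2), p ≠ 0 ∧
      c 0 • N 0 p.1 + p.2 0 • ν 0 + (c 1 • N 1 p.1 + p.2 1 • ν 1) - L p.1 = 0 := by
  obtain ⟨v, hv, hdeg⟩ := hdeg
  set y : EuclideanSpace ℝ (Fin 4) := L v - c 0 • N 0 v - c 1 • N 1 v with hydef
  have hy : ∀ w, ⟪L w, y⟫ = 0 := fun w ↦ by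
    have h := hdeg w
    rw [hz, inner_add_left, real_inner_smul_left, real_inner_smul_left] at h
    have h0 := hW 0 v w
    have h1 := hW 1 v w
    rw [hydef, inner_sub_right, inner_sub_right, real_inner_smul_right, real_inner_smul_right,
      real_inner_comm (L v) (L w), real_inner_comm (N 0 v) (L w), real_inner_comm (N 1 v) (L w)]
    linear_combination h - c 0 * h0 - c 1 * h1
  obtain ⟨d₀, d₁, hd⟩ := exists_eq_smul_add_smul_of_inner_eq_zero hL hν hli hy
  refine ⟨(v, !₂[d₀, d₁]), fun h ↦ hv (congrArg Prod.fst h), ?_⟩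
  have hd' : d₀ • ν 0 + d₁ • ν 1 = L v - c 0 • N 0 v - c 1 • N 1 v := hd.symm
  simp only [Matrix.cons_val_zero, Matrix.cons_val_one, Matrix.cons_val_fin_one]
  calc c 0 • N 0 v + d₀ • ν 0 + (c 1 • N 1 v + d₁ • ν 1) - L v
      = (d₀ • ν 0 + d₁ • ν 1) + c 0 • N 0 v + c 1 • N 1 v - L v := by abel
    _ = 0 := by rw [hd']; abel

end LinearAlgebra

/-! ### Sard: the translations with a degenerate critical point form a null set -/

section Sard

/-- **Distance-squared functions on an immersed disc are Morse for almost every centre**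
(Milnor, *Morse theory* (1963), §6, Thm. 6.6, for a `2`-disc immersed in `ℝ⁴`). For a `C^∞`
map `f : ℝ² → ℝ⁴` with injective differential on the closed unit disc, the set of translation
vectors `a` for which `y ↦ ‖f y + a‖²` has a degenerate critical point on the closed unit disc
is Lebesgue-null: by the focal-point computation (`exists_ne_zero_endpointDeriv_eq_zero`) it
consists of critical values of the equidimensional endpoint map `(x, c) ↦ Σ cᵢ nᵢ(x) - f x` of a
normal frame `n₀, n₁` of the disc (`exists_normalFrame`), which form a null set by Sard's lemma
in equal dimensions (Mathlib's `addHaar_image_eq_zero_of_det_fderivWithin_eq_zero`).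
[cite: MilnorMorseTheory1963, §6 Thm. 6.6] -/
theorem volume_setOf_degenerate_norm_add_sq_eq_zero {f : EuclideanSpace ℝ (Fin 2) → EuclideanSpace ℝ (Fin 4)} (hf : ContDiff ℝ ∞ f)
    (himm : ∀ x ∈ closedBall (0 : EuclideanSpace ℝ (Fin 2)) 1, Injective (fderiv ℝ f x)) :
    volume {a : EuclideanSpace ℝ (Fin 4) | ∃ x ∈ closedBall (0 : EuclideanSpace ℝ (Fin 2)) 1, fderiv ℝ (fun y ↦ ‖f y + a‖ ^ 2) x = 0 ∧
      ∃ v, v ≠ 0 ∧ ∀ w, iteratedFDeriv ℝ 2 (fun y ↦ ‖f y + a‖ ^ 2) x ![v, w] = 0} = 0 := by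
  -- a normal frame on a neighbourhood of the closed disc
  obtain ⟨R', n, h1R', hinjU, hnU, hfixU, hliU⟩ :=
    exists_normalFrame hf finrank_euclideanSpace_fin one_pos himm
  have hU : IsOpen (ball (0 : EuclideanSpace ℝ (Fin 2)) R') := isOpen_ball
  have horth : ∀ x ∈ ball (0 : EuclideanSpace ℝ (Fin 2)) R', ∀ i w, ⟪fderiv ℝ f x w, n i x⟫ = 0 := fun x hx i w ↦
    (normProj_eq_self_iff (hinjU x hx) _).1 (hfixU x hx i) w
  have hnd : ∀ x ∈ ball (0 : EuclideanSpace ℝ (Fin 2)) R', ∀ i, HasFDerivAt (n i) (fderiv ℝ (n i) x) x :=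
    fun x hx i ↦ (((hnU i).contDiffAt (hU.mem_nhds hx)).differentiableAt (by simp)).hasFDerivAt
  have hfd : ∀ x, HasFDerivAt f (fderiv ℝ f x) x := fun x ↦
    (hf.differentiable (by simp) x).hasFDerivAt
  -- the endpoint map `E (x, c) = c₀ n₀ x + c₁ n₁ x - f x` and its differential `E'`
  set E : EuclideanSpace ℝ (Fin 2) × EuclideanSpace ℝ (Fin 2) → EuclideanSpace ℝ (Fin 4) := fun p ↦ p.2 0 • n 0 p.1 + p.2 1 • n 1 p.1 - f p.1 with hEdef
  set φ₁ : EuclideanSpace ℝ (Fin 2) × EuclideanSpace ℝ (Fin 2) →L[ℝ] EuclideanSpace ℝ (Fin 2) := ContinuousLinearMap.fst ℝ (EuclideanSpace ℝ (Fin 2)) (EuclideanSpace ℝ (Fin 2)) with hφ₁def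
  set π₀ : EuclideanSpace ℝ (Fin 2) × EuclideanSpace ℝ (Fin 2) →L[ℝ] ℝ :=
    (EuclideanSpace.proj 0).comp (ContinuousLinearMap.snd ℝ (EuclideanSpace ℝ (Fin 2)) (EuclideanSpace ℝ (Fin 2))) with hπ₀def
  set π₁ : EuclideanSpace ℝ (Fin 2) × EuclideanSpace ℝ (Fin 2) →L[ℝ] ℝ :=
    (EuclideanSpace.proj 1).comp (ContinuousLinearMap.snd ℝ (EuclideanSpace ℝ (Fin 2)) (EuclideanSpace ℝ (Fin 2))) with hπ₁def
  set E' : EuclideanSpace ℝ (Fin 2) × EuclideanSpace ℝ (Fin 2) → (EuclideanSpace ℝ (Fin 2) × EuclideanSpace ℝ (Fin 2) →L[ℝ] EuclideanSpace ℝ (Fin 4)) := fun p ↦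
    p.2 0 • (fderiv ℝ (n 0) p.1).comp φ₁ + π₀.smulRight (n 0 p.1) +
      (p.2 1 • (fderiv ℝ (n 1) p.1).comp φ₁ + π₁.smulRight (n 1 p.1)) -
      (fderiv ℝ f p.1).comp φ₁ with hE'def
  have hE : ∀ p : EuclideanSpace ℝ (Fin 2) × EuclideanSpace ℝ (Fin 2), p.1 ∈ ball (0 : EuclideanSpace ℝ (Fin 2)) R' → HasFDerivAt E (E' p) p := by
    rintro ⟨x, c⟩ hx
    have h0 : HasFDerivAt (fun p : EuclideanSpace ℝ (Fin 2) × EuclideanSpace ℝ (Fin 2) ↦ n 0 p.1) ((fderiv ℝ (n 0) x).comp φ₁) (x, c) :=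
      (hnd x hx 0).comp (x, c) hasFDerivAt_fst
    have h1 : HasFDerivAt (fun p : EuclideanSpace ℝ (Fin 2) × EuclideanSpace ℝ (Fin 2) ↦ n 1 p.1) ((fderiv ℝ (n 1) x).comp φ₁) (x, c) :=
      (hnd x hx 1).comp (x, c) hasFDerivAt_fst
    have hf1 : HasFDerivAt (fun p : EuclideanSpace ℝ (Fin 2) × EuclideanSpace ℝ (Fin 2) ↦ f p.1) ((fderiv ℝ f x).comp φ₁) (x, c) :=
      (hfd x).comp (x, c) hasFDerivAt_fst
    have hπ₀ : HasFDerivAt (fun p : EuclideanSpace ℝ (Fin 2) × EuclideanSpace ℝ (Fin 2) ↦ p.2 0) π₀ (x, c) := π₀.hasFDerivAt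
    have hπ₁ : HasFDerivAt (fun p : EuclideanSpace ℝ (Fin 2) × EuclideanSpace ℝ (Fin 2) ↦ p.2 1) π₁ (x, c) := π₁.hasFDerivAt
    exact ((hπ₀.smul h0).add (hπ₁.smul h1)).sub hf1
  have hE'apply : ∀ (x c : EuclideanSpace ℝ (Fin 2)) (q : EuclideanSpace ℝ (Fin 2) × EuclideanSpace ℝ (Fin 2)), E' (x, c) q =
      c 0 • fderiv ℝ (n 0) x q.1 + q.2 0 • n 0 x +
        (c 1 • fderiv ℝ (n 1) x q.1 + q.2 1 • n 1 x) - fderiv ℝ f x q.1 := by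
    intro x c q
    simp [hE'def, hπ₀def, hπ₁def, hφ₁def]
  -- identification `ℝ² × ℝ² ≃ ℝ⁴`; Sard's lemma for the equidimensional map `E ∘ Λ⁻¹`
  set Λ : (EuclideanSpace ℝ (Fin 2) × EuclideanSpace ℝ (Fin 2)) ≃L[ℝ] EuclideanSpace ℝ (Fin 4) := ContinuousLinearEquiv.ofFinrankEq (by simp)
  set S : Set (EuclideanSpace ℝ (Fin 4)) :=
    {q | (Λ.symm q).1 ∈ ball (0 : EuclideanSpace ℝ (Fin 2)) R' ∧ ¬ Injective (E' (Λ.symm q))} with hSdef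
  have hnull : volume ((E ∘ Λ.symm) '' S) = 0 := by
    refine addHaar_image_eq_zero_of_det_fderivWithin_eq_zero volume
      (f' := fun q ↦ (E' (Λ.symm q)).comp (Λ.symm : EuclideanSpace ℝ (Fin 4) →L[ℝ] EuclideanSpace ℝ (Fin 2) × EuclideanSpace ℝ (Fin 2)))
      (fun q hq ↦ ((hE _ hq.1).comp q Λ.symm.hasFDerivAt).hasFDerivWithinAt) (fun q hq ↦ ?_)
    apply Literature.Analysis.Calculus.det_eq_zero_of_not_surjective
    intro hsurj
    have hinj : Injective ((E' (Λ.symm q)).comp (Λ.symm : EuclideanSpace ℝ (Fin 4) →L[ℝ] EuclideanSpace ℝ (Fin 2) × EuclideanSpace ℝ (Fin 2))) := by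
      rw [← ContinuousLinearMap.coe_coe]
      exact LinearMap.injective_iff_surjective.2 hsurj
    refine hq.2 fun p₁ p₂ hp ↦ Λ.injective (hinj ?_)
    simp only [ContinuousLinearMap.coe_comp, comp_apply, ContinuousLinearEquiv.coe_coe,
      ContinuousLinearEquiv.symm_apply_apply, hp]
  refine measure_mono_null ?_ hnull
  rintro a ⟨x, hx, hcrit, v, hv, hdeg⟩
  have hxU : x ∈ ball (0 : EuclideanSpace ℝ (Fin 2)) R' := closedBall_subset_ball h1R' hx
  have hL := hinjU x hxU
  -- the critical point condition: `f x + a` is normal, hence `= c₀ n₀ x + c₁ n₁ x`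
  have hza : ∀ w, ⟪fderiv ℝ f x w, f x + a⟫ = 0 := fun w ↦ by
    have h := fderiv_norm_add_sq_apply (hf.differentiable (by simp) x) a w
    rw [hcrit, zero_apply] at h
    rw [real_inner_comm]
    linarith
  obtain ⟨c₀, c₁, hc⟩ :=
    exists_eq_smul_add_smul_of_inner_eq_zero hL (fun i w ↦ horth x hxU i w) (hliU x hxU) hza
  -- the Weingarten identity and the degeneracy give a kernel vector of `E' (x, c)`
  have hW : ∀ i v w, ⟪fderiv ℝ (n i) x v, fderiv ℝ f x w⟫ +
      ⟪n i x, iteratedFDeriv ℝ 2 f x ![v, w]⟫ = 0 := by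
    intro i v w
    refine inner_fderiv_normal_add_inner_iteratedFDeriv hf (hnd x hxU i).differentiableAt ?_ v w
    filter_upwards [hU.mem_nhds hxU] with y hy w
    rw [real_inner_comm]
    exact horth y hy i w
  have hdeg' : ∃ v, v ≠ 0 ∧ ∀ w, ⟪fderiv ℝ f x v, fderiv ℝ f x w⟫ +
      ⟪f x + a, iteratedFDeriv ℝ 2 f x ![v, w]⟫ = 0 := by
    refine ⟨v, hv, fun w ↦ ?_⟩
    have h := hdeg w
    rw [iteratedFDeriv_two_norm_add_sq hf] at h
    linarith
  have hc' : f x + a = (!₂[c₀, c₁] : EuclideanSpace ℝ (Fin 2)) 0 • n 0 x + (!₂[c₀, c₁] : EuclideanSpace ℝ (Fin 2)) 1 • n 1 x := by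
    simpa using hc
  obtain ⟨p, hp, hEp⟩ := exists_ne_zero_endpointDeriv_eq_zero hL (fun i w ↦ horth x hxU i w)
    (hliU x hxU) (N := fun i ↦ fderiv ℝ (n i) x) (B := fun v w ↦ iteratedFDeriv ℝ 2 f x ![v, w])
    hW hc' hdeg'
  refine ⟨Λ (x, !₂[c₀, c₁]), ⟨?_, ?_⟩, ?_⟩
  · simpa using hxU
  · rw [ContinuousLinearEquiv.symm_apply_apply]
    intro hinj
    refine hp (hinj ?_)
    rw [hE'apply, map_zero]
    exact hEp
  · simp only [comp_apply, ContinuousLinearEquiv.symm_apply_apply, hEdef]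
    rw [← hc', add_sub_cancel_left]

end Sard

/-! ### Neatness gives a collar without critical points, stable under perturbation -/

section Collar

/-- **A neat disc has no radial critical points near its boundary.** If the radial derivative
of `‖f‖²` is positive along the unit circle, it is positive on a collar `1 - η ≤ ‖x‖ ≤ 1`
(compactness of the circle and continuity of the derivative). [folklore] -/
theorem exists_collar_fderiv_norm_sq_pos {f : EuclideanSpace ℝ (Fin 2) → EuclideanSpace ℝ (Fin 4)} (hf : ContDiff ℝ ∞ f)
    (hneat : ∀ x : EuclideanSpace ℝ (Fin 2), ‖x‖ = 1 → 0 < fderiv ℝ (fun y ↦ ‖f y‖ ^ 2) x x) :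
    ∃ η : ℝ, 0 < η ∧ η < 1 ∧
      ∀ x : EuclideanSpace ℝ (Fin 2), 1 - η ≤ ‖x‖ → ‖x‖ ≤ 1 → 0 < fderiv ℝ (fun y ↦ ‖f y‖ ^ 2) x x := by
  set Q : EuclideanSpace ℝ (Fin 2) → ℝ := fun x ↦ fderiv ℝ (fun y ↦ ‖f y‖ ^ 2) x x with hQdef
  have hQ : Continuous Q :=
    ((hf.norm_sq ℝ).continuous_fderiv (by simp)).clm_apply continuous_id
  have key := (isCompact_sphere (0 : EuclideanSpace ℝ (Fin 2)) 1).eventually_forall_of_forall_eventually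
    (x₀ := (1 : ℝ)) (P := fun t u ↦ 0 < Q (t • u)) (fun u hu ↦ ?_)
  · obtain ⟨ε, hε, hball⟩ := eventually_nhds_iff_ball.1 key
    refine ⟨min (ε / 2) (1 / 2), by positivity, by linarith [min_le_right (ε / 2) (1 / 2)],
      fun x hx1 hx2 ↦ ?_⟩
    have ht0 : 0 < ‖x‖ := by linarith [min_le_right (ε / 2) (1 / 2)]
    have hu : ‖x‖⁻¹ • x ∈ sphere (0 : EuclideanSpace ℝ (Fin 2)) 1 := by
      rw [mem_sphere_zero_iff_norm, norm_smul, norm_inv, norm_norm, inv_mul_cancel₀ ht0.ne']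
    have ht : ‖x‖ ∈ ball (1 : ℝ) ε := by
      rw [mem_ball, Real.dist_eq, abs_lt]
      constructor <;> linarith [min_le_left (ε / 2) (1 / 2)]
    have h := hball _ ht _ hu
    rwa [smul_inv_smul₀ ht0.ne'] at h
  · have hu1 : ‖u‖ = 1 := by rwa [mem_sphere_zero_iff_norm] at hu
    have hc : Continuous fun z : ℝ × EuclideanSpace ℝ (Fin 2) ↦ Q (z.1 • z.2) :=
      hQ.comp (continuous_fst.smul continuous_snd)
    have h0 : 0 < Q ((1 : ℝ) • u) := by rw [one_smul]; exact hneat u hu1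
    exact (hc.tendsto (1, u)).eventually_const_lt h0

/-- **Stability of the collar under the perturbation `f ↦ f + (β ∘ f) • a`.** If the radial
derivative of `‖f‖²` is positive on a compact set `Kc`, then for all sufficiently small `a` the
radial derivative of `‖f + (β ∘ f) • a‖²` is positive on `Kc` (joint continuity in `(a, x)` of
the derivative and compactness, via `IsCompact.eventually_forall_of_forall_eventually`).
[folklore] -/
theorem eventually_forall_fderiv_norm_sq_pos {f : EuclideanSpace ℝ (Fin 2) → EuclideanSpace ℝ (Fin 4)} (hf : ContDiff ℝ ∞ f)
    {β : EuclideanSpace ℝ (Fin 4) → ℝ} (hβ : ContDiff ℝ ∞ β) {Kc : Set (EuclideanSpace ℝ (Fin 2))} (hK : IsCompact Kc)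
    (hpos : ∀ x ∈ Kc, 0 < fderiv ℝ (fun y ↦ ‖f y‖ ^ 2) x x) :
    ∀ᶠ a in 𝓝 (0 : EuclideanSpace ℝ (Fin 4)), ∀ x ∈ Kc, 0 < fderiv ℝ (fun y ↦ ‖f y + β (f y) • a‖ ^ 2) x x := by
  set Ψ : EuclideanSpace ℝ (Fin 4) × EuclideanSpace ℝ (Fin 2) → ℝ := fun p ↦ ‖f p.2 + β (f p.2) • p.1‖ ^ 2 with hΨdef
  have hΨ : ContDiff ℝ ∞ Ψ :=
    ((hf.comp contDiff_snd).add ((hβ.comp (hf.comp contDiff_snd)).smul contDiff_fst)).norm_sq ℝ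
  have hΨd : Differentiable ℝ Ψ := hΨ.differentiable (by simp)
  have hpart : ∀ (a : EuclideanSpace ℝ (Fin 4)) (x v : EuclideanSpace ℝ (Fin 2)),
      fderiv ℝ (fun y ↦ ‖f y + β (f y) • a‖ ^ 2) x v = fderiv ℝ Ψ (a, x) (0, v) := by
    intro a x v
    have h : (fun y ↦ ‖f y + β (f y) • a‖ ^ 2) = Ψ ∘ fun y ↦ (a, y) := rfl
    rw [h, fderiv_comp x (hΨd _) (hasFDerivAt_prodMk_right a x).differentiableAt,
      (hasFDerivAt_prodMk_right a x).fderiv]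
    rfl
  have hcont : Continuous fun p : EuclideanSpace ℝ (Fin 4) × EuclideanSpace ℝ (Fin 2) ↦ fderiv ℝ Ψ p (0, p.2) :=
    (hΨ.continuous_fderiv (by simp)).clm_apply (continuous_const.prodMk continuous_snd)
  have key := hK.eventually_forall_of_forall_eventually (x₀ := (0 : EuclideanSpace ℝ (Fin 4)))
    (P := fun a x ↦ 0 < fderiv ℝ Ψ (a, x) (0, x)) (fun x hx ↦ ?_)
  · filter_upwards [key] with a ha x hx
    rw [hpart]
    exact ha x hx
  · have h0 : 0 < fderiv ℝ Ψ (0, x) (0, x) := by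
      rw [← hpart]
      simpa using hpos x hx
    have := (hcont.tendsto (0, x)).eventually_const_lt h0
    simpa only [Prod.mk.eta] using this

end Collar

/-! ### Transport of slice discs by the perturbation -/

section Transport

/-- **The perturbed disc is a slice disc of the same knot.** Let `f` be a slice disc of `K`,
`φ` a smooth bump function on `ℝ⁴` centred at `0` with outer radius `< 1` (so `φ = 0` near the
unit sphere) and Lipschitz constant `C`. For `‖a‖ < 1 - r_out` and `C ‖a‖ < 1` the map
`y ↦ f y + φ (f y) • a` — the image of `f` under the diffeomorphism `z ↦ z + φ z • a` of `ℝ⁴`,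
which preserves the open unit ball and is the identity near `𝕊³` — is again a slice disc of
`K`: smooth, injective and immersive on the closed disc, interior in the open ball, and equal
to `f` near the boundary circle (where neatness and the boundary values live). [folklore] -/
theorem Knot.IsSliceDisc.add_bump_smul {K : Knot} {f : EuclideanSpace ℝ (Fin 2) → EuclideanSpace ℝ (Fin 4)} (hf : K.IsSliceDisc f)
    (φ : ContDiffBump (0 : EuclideanSpace ℝ (Fin 4))) (hφ : φ.rOut < 1) {C : ℝ≥0} (hC : LipschitzWith C φ)
    {a : EuclideanSpace ℝ (Fin 4)} (haC : (C : ℝ) * ‖a‖ < 1) (ha : ‖a‖ < 1 - φ.rOut) :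
    K.IsSliceDisc (fun y ↦ f y + φ (f y) • a) := by
  obtain ⟨hfs, hfinj, hfimm, hfint, hfneat, hfK⟩ := hf
  have hφs : ContDiff ℝ ∞ φ := φ.contDiff
  have hgs : ContDiff ℝ ∞ (fun y ↦ f y + φ (f y) • a) :=
    hfs.add ((hφs.comp hfs).smul contDiff_const)
  -- the differential of the perturbed disc
  have hDg : ∀ x, HasFDerivAt (fun y ↦ f y + φ (f y) • a)
      (fderiv ℝ f x + ((fderiv ℝ φ (f x)).comp (fderiv ℝ f x)).smulRight a) x := fun x ↦ by
    have h1 : HasFDerivAt f (fderiv ℝ f x) x := (hfs.differentiable (by simp) x).hasFDerivAt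
    have h2 : HasFDerivAt φ (fderiv ℝ φ (f x)) (f x) :=
      (hφs.differentiable (by simp) _).hasFDerivAt
    exact h1.add ((h2.comp x h1).smul_const a)
  -- `φ` vanishes outside its outer ball, in particular near the boundary values of `f`
  have hφ0 : ∀ z : EuclideanSpace ℝ (Fin 4), φ.rOut ≤ ‖z‖ → φ z = 0 := fun z hz ↦
    φ.zero_of_le_dist (by rwa [dist_zero_right])
  have hbd : ∀ x : EuclideanSpace ℝ (Fin 2), ‖x‖ = 1 → ‖f x‖ = 1 := fun x hx ↦ by
    rw [show f x = _ from hfK ⟨x, by rwa [mem_sphere_zero_iff_norm]⟩, norm_eq_of_mem_sphere]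
  have hDφ : ∀ z : EuclideanSpace ℝ (Fin 4), ‖fderiv ℝ φ z‖ ≤ C := fun z ↦ norm_fderiv_le_of_lipschitz ℝ hC
  refine ⟨hgs, ?_, ?_, ?_, ?_, ?_⟩
  · -- injective on the closed disc
    intro x hx y hy hxy
    apply hfinj hx hy
    have h : f x - f y = (φ (f y) - φ (f x)) • a := by
      rw [sub_smul, sub_eq_sub_iff_add_eq_add, add_comm (φ (f y) • a)]
      exact hxy
    have hn : ‖f x - f y‖ ≤ C * ‖a‖ * ‖f x - f y‖ :=
      calc ‖f x - f y‖ = |φ (f y) - φ (f x)| * ‖a‖ := by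
            conv_lhs => rw [h]
            rw [norm_smul, Real.norm_eq_abs]
        _ ≤ C * ‖f y - f x‖ * ‖a‖ := by
            gcongr
            have := hC.dist_le_mul (f y) (f x)
            rwa [Real.dist_eq, dist_eq_norm] at this
        _ = C * ‖a‖ * ‖f x - f y‖ := by rw [norm_sub_rev]; ring
    by_contra hne
    have hpos : 0 < ‖f x - f y‖ := norm_pos_iff.2 (sub_ne_zero.2 hne)
    nlinarith
  · -- immersive on the closed disc
    intro x hx
    rw [(hDg x).fderiv]
    refine (injective_iff_map_eq_zero _).2 fun v hv ↦ ?_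
    have hv' : fderiv ℝ f x v = -(fderiv ℝ φ (f x) (fderiv ℝ f x v)) • a := by
      rw [neg_smul, eq_neg_iff_add_eq_zero]
      simpa using hv
    have hn : ‖fderiv ℝ f x v‖ ≤ C * ‖a‖ * ‖fderiv ℝ f x v‖ :=
      calc ‖fderiv ℝ f x v‖ = |fderiv ℝ φ (f x) (fderiv ℝ f x v)| * ‖a‖ := by
            conv_lhs => rw [hv']
            rw [norm_smul, norm_neg, Real.norm_eq_abs]
        _ ≤ C * ‖fderiv ℝ f x v‖ * ‖a‖ := by
            gcongr
            rw [← Real.norm_eq_abs]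
            exact (fderiv ℝ φ (f x)).le_of_opNorm_le (hDφ _) _
        _ = C * ‖a‖ * ‖fderiv ℝ f x v‖ := by ring
    have h0 : fderiv ℝ f x v = 0 := by
      by_contra hne
      have hpos : 0 < ‖fderiv ℝ f x v‖ := norm_pos_iff.2 hne
      nlinarith
    exact (injective_iff_map_eq_zero _).1 (hfimm x hx) v h0
  · -- the open disc is mapped into the open ball
    intro x hx
    show ‖f x + φ (f x) • a‖ < 1
    rcases lt_or_ge ‖f x‖ φ.rOut with h1 | h1
    · calc ‖f x + φ (f x) • a‖ ≤ ‖f x‖ + ‖φ (f x) • a‖ := norm_add_le _ _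
        _ ≤ ‖f x‖ + ‖a‖ := by
            rw [norm_smul, Real.norm_eq_abs, abs_of_nonneg φ.nonneg]
            gcongr
            exact mul_le_of_le_one_left (norm_nonneg _) φ.le_one
        _ < 1 := by linarith
    · rw [hφ0 _ h1, zero_smul, add_zero]
      exact hfint x hx
  · -- neat: the perturbed disc agrees with `f` near the boundary circle
    intro x hx
    have hfx := hbd x hx
    have hev : (fun y ↦ ‖f y + φ (f y) • a‖ ^ 2) =ᶠ[𝓝 x] fun y ↦ ‖f y‖ ^ 2 := by
      have hc : ContinuousAt (fun y ↦ ‖f y‖) x := hfs.continuous.norm.continuousAt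
      have : ∀ᶠ y in 𝓝 x, φ.rOut < ‖f y‖ :=
        hc.eventually (lt_mem_nhds (show φ.rOut < ‖f x‖ by rw [hfx]; exact hφ))
      filter_upwards [this] with y hy
      rw [hφ0 _ hy.le, zero_smul, add_zero]
    rw [hev.fderiv_eq]
    exact hfneat x hx
  · -- boundary values
    intro x
    have h1 : ‖f x‖ = 1 := by rw [hfK x]; exact norm_eq_of_mem_sphere _
    show f x + φ (f x) • a = K x
    rw [hφ0 _ (by rw [h1]; exact hφ.le), zero_smul, add_zero, hfK x]

end Transport

/-! ### The theorem -/

/-- **Every smooth slice disc can be replaced by a slice disc of the same knot whose radius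
function is Morse on the open disc.** Given a slice disc `f` of `K`, there is a slice disc `g`
of `K` such that every critical point of `ρ_g = ‖g‖²` in the open unit disc is nondegenerate.
*Proof.* By neatness, `ρ_f` has no critical points on a collar `1 - η ≤ ‖x‖ ≤ 1`
(`exists_collar_fderiv_norm_sq_pos`); the disc `‖x‖ ≤ 1 - η` is mapped into a ball
`‖z‖ ≤ M < r₁ < r₂ < 1`. Perturb `f` to `g = f + (φ ∘ f) • a`, `φ` a bump function equal to `1`
on `‖z‖ ≤ r₁` and to `0` on `‖z‖ ≥ r₂`: for `a` small, `g` is a slice disc of `K`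
(`Knot.IsSliceDisc.add_bump_smul`), `ρ_g` still has no critical points on the collar
(`eventually_forall_fderiv_norm_sq_pos`), and `ρ_g = ‖f + a‖²` near every point of the inner
disc; by Sard's theorem applied to the endpoint map of a normal frame (Milnor, *Morse theory*
(1963), §6, Thm. 6.6: for almost every `p` the distance-squared from `p` is a Morse function on
an immersed submanifold — `volume_setOf_degenerate_norm_add_sq_eq_zero`), the admissible `a`
(a set of positive measure) contain one for which `‖f + a‖²` has only nondegenerate critical
points on the disc. [cite: MilnorMorseTheory1963, §6 Thm. 6.6] -/
theorem Knot.IsSliceDisc.exists_isSliceDisc_radialMorse {K : Knot}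
    {f : EuclideanSpace ℝ (Fin 2) → EuclideanSpace ℝ (Fin 4)} (hf : K.IsSliceDisc f) :
    ∃ g : EuclideanSpace ℝ (Fin 2) → EuclideanSpace ℝ (Fin 4), K.IsSliceDisc g ∧
      ∀ x : EuclideanSpace ℝ (Fin 2), ‖x‖ < 1 → fderiv ℝ (fun y ↦ ‖g y‖ ^ 2) x = 0 →
        ∀ v : EuclideanSpace ℝ (Fin 2), v ≠ 0 →
          ∃ w : EuclideanSpace ℝ (Fin 2), iteratedFDeriv ℝ 2 (fun y ↦ ‖g y‖ ^ 2) x ![v, w] ≠ 0 := by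
  have hfs : ContDiff ℝ ∞ f := hf.1
  have hfimm : ∀ x ∈ closedBall (0 : EuclideanSpace ℝ (Fin 2)) 1, Injective (fderiv ℝ f x) := hf.2.2.1
  have hfint : ∀ x : EuclideanSpace ℝ (Fin 2), ‖x‖ < 1 → ‖f x‖ < 1 := hf.2.2.2.1
  -- Step 1: a collar without critical points of `‖f‖²`
  obtain ⟨η, hη0, hη1, hcollar⟩ := exists_collar_fderiv_norm_sq_pos hfs hf.2.2.2.2.1
  -- Step 2: the inner disc is mapped into a ball of radius `M < 1`
  obtain ⟨x₀, hx₀, hmax⟩ := (isCompact_closedBall (0 : EuclideanSpace ℝ (Fin 2)) (1 - η)).exists_isMaxOn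
    ⟨0, by simp; linarith⟩ hfs.continuous.norm.continuousOn
  set M : ℝ := ‖f x₀‖ with hMdef
  have hM1 : M < 1 := hfint x₀ (by
    have : ‖x₀‖ ≤ 1 - η := by simpa using hx₀
    linarith)
  have hM0 : 0 ≤ M := norm_nonneg _
  have hMle : ∀ x : EuclideanSpace ℝ (Fin 2), ‖x‖ ≤ 1 - η → ‖f x‖ ≤ M := fun x hx ↦ hmax (by simpa using hx)
  -- Step 3: the bump function `φ = 1` on `‖z‖ ≤ r₁`, `φ = 0` on `‖z‖ ≥ r₂`, `M < r₁ < r₂ < 1`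
  set r₁ : ℝ := (M + 1) / 2 with hr₁def
  set r₂ : ℝ := (M + 3) / 4 with hr₂def
  have hMr₁ : M < r₁ := by rw [hr₁def]; linarith
  have hr₁r₂ : r₁ < r₂ := by rw [hr₁def, hr₂def]; linarith
  have hr₂1 : r₂ < 1 := by rw [hr₂def]; linarith
  let φ : ContDiffBump (0 : EuclideanSpace ℝ (Fin 4)) := ⟨r₁, r₂, by rw [hr₁def]; linarith, hr₁r₂⟩
  have hφs : ContDiff ℝ ∞ φ := φ.contDiff
  obtain ⟨C, hC⟩ := hφs.lipschitzWith_of_hasCompactSupport φ.hasCompactSupport (by simp)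
  -- Step 4: the admissible translations form a neighbourhood of `0`
  have h1 : ∀ᶠ a in 𝓝 (0 : EuclideanSpace ℝ (Fin 4)), (C : ℝ) * ‖a‖ < 1 := by
    have : Tendsto (fun a : EuclideanSpace ℝ (Fin 4) ↦ (C : ℝ) * ‖a‖) (𝓝 0) (𝓝 ((C : ℝ) * ‖(0 : EuclideanSpace ℝ (Fin 4))‖)) :=
      (continuous_const.mul continuous_norm).tendsto 0
    rw [norm_zero, mul_zero] at this
    exact this.eventually_lt_const one_pos
  have h2 : ∀ᶠ a in 𝓝 (0 : EuclideanSpace ℝ (Fin 4)), ‖a‖ < 1 - r₂ := by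
    have : Tendsto (fun a : EuclideanSpace ℝ (Fin 4) ↦ ‖a‖) (𝓝 0) (𝓝 ‖(0 : EuclideanSpace ℝ (Fin 4))‖) := continuous_norm.tendsto 0
    rw [norm_zero] at this
    exact this.eventually_lt_const (by linarith)
  have hKc : IsCompact (closedBall (0 : EuclideanSpace ℝ (Fin 2)) 1 \ ball 0 (1 - η)) :=
    (isCompact_closedBall 0 1).diff isOpen_ball
  have h3 : ∀ᶠ a in 𝓝 (0 : EuclideanSpace ℝ (Fin 4)), ∀ x ∈ closedBall (0 : EuclideanSpace ℝ (Fin 2)) 1 \ ball 0 (1 - η),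
      0 < fderiv ℝ (fun y ↦ ‖f y + φ (f y) • a‖ ^ 2) x x := by
    refine eventually_forall_fderiv_norm_sq_pos hfs hφs hKc fun x hx ↦ hcollar x ?_ ?_
    · simpa [not_lt] using hx.2
    · simpa using hx.1
  obtain ⟨δ, hδ, hδP⟩ := eventually_nhds_iff_ball.1 (h1.and (h2.and h3))
  -- Step 5: Sard — pick an admissible translation avoiding the null set of degenerate ones
  have hnull := volume_setOf_degenerate_norm_add_sq_eq_zero hfs hfimm
  obtain ⟨a, ha, hgood⟩ := not_subset.1 fun h ↦
    (measure_ball_pos volume (0 : EuclideanSpace ℝ (Fin 4)) hδ).ne' (measure_mono_null h hnull)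
  obtain ⟨haC, har, hacol⟩ := hδP a ha
  -- the perturbed disc
  refine ⟨fun y ↦ f y + φ (f y) • a, hf.add_bump_smul φ hr₂1 hC haC har, ?_⟩
  intro x hx hcrit v hv
  by_cases hxη : 1 - η ≤ ‖x‖
  · -- no critical points on the collar
    have h := hacol x ⟨by simpa using hx.le, by simpa [not_lt] using hxη⟩
    rw [hcrit, zero_apply] at h
    exact absurd h (lt_irrefl 0)
  · -- on the inner disc the perturbed disc is the translate `f + a` near `x`
    rw [not_le] at hxη
    have hloc : (fun y ↦ ‖f y + φ (f y) • a‖ ^ 2) =ᶠ[𝓝 x] fun y ↦ ‖f y + a‖ ^ 2 := by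
      have hc : ContinuousAt (fun y ↦ ‖f y‖) x := hfs.continuous.norm.continuousAt
      have : ∀ᶠ y in 𝓝 x, ‖f y‖ < r₁ :=
        hc.eventually (gt_mem_nhds (lt_of_le_of_lt (hMle x hxη.le) hMr₁))
      filter_upwards [this] with y hy
      rw [φ.one_of_mem_closedBall (by simpa using hy.le), one_smul]
    have hcrit' : fderiv ℝ (fun y ↦ ‖f y + a‖ ^ 2) x = 0 := by rw [← hloc.fderiv_eq]; exact hcrit
    simp only [mem_setOf_eq, not_exists, not_and, not_forall] at hgood
    obtain ⟨w, hw⟩ := hgood x (by simpa using hx.le) hcrit' v hv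
    refine ⟨w, ?_⟩
    rw [(hloc.iteratedFDeriv ℝ 2).self_of_nhds]
    exact hw

end Literature.Topology.FourManifolds
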